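import Summits.Langlands.Langlands.Theses.PicardMuOrdinary
import Literature.NumberTheory.Automorphic.AsaiSign
import Literature.NumberTheory.Automorphic.SatakeParamNeZeroProofs

/-!
# `IrregularClassicality` (stmt-Langlands-13758) — Negative knowledge VIII: the restated
# (twisted-polarized) interface at conjugation-fixed places — `±1 ∈ Sat(Π, w)` — and the parity
# threshold behind the rejection of the untwisted restate

From the standing disprover's `Cruxes/IrregularClassicality/Disproof.lean`, cdisprove cycle 4
(2026-08-16), §13.  All three line cards of the crux, the planner's parity note and the drefute seat
recommend restating the 13757 → 13758 interface in the twisted-polarized normal form: tower members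
`Π_k` regular algebraic cuspidal on `GL₃(𝔸_K)` with `IsConjSelfDualAE c₀`, congruent to the
ψ-twisted traces `e(a_𝔭(f)·ϖ_𝔭)`.  Pre-audit of that interface at the places FIXED by `c₀` (the
inert primes `(p)`, `p ≡ 2 (3)`, and `λ`):

* `exists_inv_eq_self_of_map_inv_eq`, `one_mem_or_neg_one_mem_of_map_inv_eq`: an inversion-stable
  multiset of odd cardinality has a self-inverse member; in a field, avoiding `0`, it contains `1`
  or `-1` (pure combinatorics: pair `b ↔ b⁻¹`);
* `conjSelfDual_one_mem_or_neg_one_mem_satake`: UNCONDITIONALLY (the tree's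
  `hasSatakeParamAt_ne_zero_holds` and `card = 3`), a conjugate-self-dual `Π` on `GL₃/E` has `1` or
  `-1` in its Satake parameter at all but finitely many `c`-fixed places — the `GL₃`-side twin of
  `twistedUnitaryTower_baseChangeSatake_of_fixed` (Negative V).  Paper complement recorded in the
  Disproof file (item 27): against the inert supersingular factor `{-p, γ, p²/γ}` of `V_e` the
  congruence pins the sign to `+1` (and `p² b → -pγ`) whenever `a_𝔭(f) ∉ {p, -3p}` — a numerical
  admissibility test for candidate towers;
* `cube_of_one_mod_three_mod_nine`, `exists_cube_of_one_mod_three_ne_one_mod_twentyseven`: the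
  decide-checked arithmetic behind the parity threshold — `ε(Γ_K) = 1 + 3ℤ₃`, cubes of such
  elements are `≡ 1 (mod 9)` but not `(mod 27)` (`4³ = 64 ≡ 10`), so an UNTWISTED exactly polarized
  regular `P` (`det r·(det r)^c = ε^{-6}` versus `ε^{-3}` for `ρ_C`) matches `ρ_C` to depth
  `3^{k-1} ∣ 9` at most: the literal `IsConjSelfDualAE` restate of the interface is inconsistent
  for `k ≥ 4`, as the parity note says.

Mathlib + the route file + `Literature/NumberTheory/Automorphic/{AsaiSign, SatakeParamNeZeroProofs}`.
No statement here asserts a Theses decl. [folklore]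
-/

set_option linter.dupNamespace false

namespace Summit.Langlands.Langlands.Theorems.IrregularClassicality.Negative

open Literature.NumberTheory.Automorphic
open NumberField IsDedekindDomain Filter

open scoped Classical

/-- **An inversion-stable multiset of odd cardinality has a self-inverse member** (remove a pair
`a, a⁻¹` and induct on the cardinality). [folklore] -/
theorem exists_inv_eq_self_of_map_inv_eq {F : Type*} [DivisionRing F] :
    ∀ (n : ℕ) (s : Multiset F), Multiset.card s = n → s.map (·⁻¹) = s → Odd n →
      ∃ b ∈ s, b⁻¹ = b := by
  intro n
  induction n using Nat.strong_induction_on with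
  | _ n ih =>
    intro s hn hs hodd
    by_contra hne
    push Not at hne
    have hpos : 0 < Multiset.card s := by rw [hn]; exact hodd.pos
    obtain ⟨a, ha⟩ := Multiset.card_pos_iff_exists_mem.1 hpos
    have ha' : a⁻¹ ∈ s := by
      have := Multiset.mem_map_of_mem (·⁻¹) ha
      rwa [hs] at this
    have hne_a : a⁻¹ ≠ a := hne a ha
    set s₂ := (s.erase a).erase a⁻¹ with hs₂def
    have hdec : s = a ::ₘ a⁻¹ ::ₘ s₂ := by
      rw [hs₂def, Multiset.cons_erase ((Multiset.mem_erase_of_ne hne_a).2 ha'), Multiset.cons_erase ha]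
    have hs₂ : s₂.map (·⁻¹) = s₂ := by
      have h := hs
      rw [hdec, Multiset.map_cons, Multiset.map_cons, inv_inv, Multiset.cons_swap] at h
      exact (Multiset.cons_inj_right _).1 ((Multiset.cons_inj_right _).1 h)
    have hcard₂ : Multiset.card s₂ + 2 = n := by
      rw [← hn, hdec]; simp
    have hodd₂ : Odd (Multiset.card s₂) := by
      obtain ⟨k, hk⟩ := hodd
      exact ⟨k - 1, by omega⟩
    have hsub : ∀ b ∈ s₂, b ∈ s := fun b hb =>
      Multiset.mem_of_mem_erase (Multiset.mem_of_mem_erase hb)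
    obtain ⟨b, hb, hbb⟩ := ih (Multiset.card s₂) (by omega) s₂ rfl hs₂ hodd₂
    exact hne b (hsub b hb) hbb

/-- Hence, in a field, an inversion-stable multiset of odd cardinality avoiding `0` contains `1`
or `-1`. [folklore] -/
theorem one_mem_or_neg_one_mem_of_map_inv_eq {F : Type*} [Field F] {s : Multiset F}
    (hs : s.map (·⁻¹) = s) (hodd : Odd (Multiset.card s)) (h0 : ∀ a ∈ s, a ≠ 0) :
    (1 : F) ∈ s ∨ (-1 : F) ∈ s := by
  obtain ⟨b, hb, hbb⟩ := exists_inv_eq_self_of_map_inv_eq _ s rfl hs hodd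
  have hb0 := h0 b hb
  have hb1 : b * b = 1 := by
    calc b * b = b⁻¹ * b := by rw [hbb]
      _ = 1 := inv_mul_cancel₀ hb0
  rcases mul_self_eq_one_iff.1 hb1 with rfl | rfl
  · exact Or.inl hb
  · exact Or.inr hb

/-- **Shape of the restated interface at `c`-fixed places.**  UNCONDITIONALLY: a
conjugate-self-dual automorphic `Π` on `GL₃(𝔸_E)` (`IsConjSelfDualAE c`: `Sat(Π, c • w) = Sat(Π, w)⁻¹`
a.e.) has `1 ∈ Sat(Π, w)` or `-1 ∈ Sat(Π, w)` at all but finitely many places `w` with `c • w = w`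
— for `E = ℚ(ω)`, `F = ℚ`: at almost every inert prime.  (Satake parameters are non-zero by the
tree's `hasSatakeParamAt_ne_zero_holds`, and have `card = 3`.) [folklore] -/
theorem conjSelfDual_one_mem_or_neg_one_mem_satake {F E : Type} [Field F] [NumberField F]
    [Field E] [NumberField E] [Algebra F E] {hcpt : isCompact_glFiniteIntegralLevel 3 E}
    {P : AutomorphicRepData (AutomorphyDatum.gl 3 E hcpt)} {c : E ≃ₐ[F] E}
    (h : P.IsConjSelfDualAE c) :
    ∀ᶠ w : HeightOneSpectrum (𝓞 E) in cofinite, c • w = w → ∀ α : Multiset ℂ,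
      P.HasSatakeParamAt w α → (1 : ℂ) ∈ α ∨ (-1 : ℂ) ∈ α := by
  refine h.mono fun w hw hcw α hα => ?_
  have hinv : α.map (·⁻¹) = α := (hw α α hα (by rw [hcw]; exact hα)).symm
  refine one_mem_or_neg_one_mem_of_map_inv_eq hinv ?_ (hasSatakeParamAt_ne_zero_holds hα)
  rw [hα.card_eq]
  decide

/-- **Parity threshold, I**: cubes of elements `≡ 1 (mod 3)` are `≡ 1 (mod 9)` (so `ε³ ≡ 1 mod 9`
on `Γ_K`, `ε(Γ_K) = 1 + 3ℤ₃`). [folklore] -/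
theorem cube_of_one_mod_three_mod_nine : ∀ y : ZMod 9, (1 + 3 * y) ^ 3 = 1 := by decide

/-- **Parity threshold, II**: … but not `≡ 1 (mod 27)` — `(1 + 3)³ = 64 = 10` in `ZMod 27`.  Hence an
untwisted exactly conjugate-self-dual regular `P` can be congruent to `ρ_C` only to depth
`3^{k-1} ∣ 9`, `k ≤ 3`. [folklore] -/
theorem exists_cube_of_one_mod_three_ne_one_mod_twentyseven :
    ∃ y : ZMod 27, (1 + 3 * y) ^ 3 ≠ 1 :=
  ⟨1, by decide⟩

end Summit.Langlands.Langlands.Theorems.IrregularClassicality.Negative
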